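import Literature.ModelTheory.ExponentialFields.SemialgebraicLensTools
import HarnessLib

/-!
# Pawłucki's lenses (capsule refinement subordinate to an open cover, II: Part I)

Topic `Literature/ModelTheory/ExponentialFields` — block B2b of the proof of the
`C¹`-triangulation theorem for compact semialgebraic sets
(`Literature.ModelTheory.ExponentialFields.OhmotoShiota2017_c1Triangulation`, statement of
[OhmotoShiota2017, Thm. 1.1]) along the proof of [Pawlucki2024], specialized to `p = 1`.

**Part I of the proof of [Pawlucki2024, Prop. 2.5].**  Over a stratum `Γ` (a cell of a
cylindrical decomposition, straightened by its chart `x ↦ x ∘ ι`, [Dries1998, Ch. 3 (2.7)]) on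
which the bottom graph `a` has collars `{y} × (a y, e y] ⊆ V` inside one member `V` of the cover,
with `e` continuous, Pawłucki builds a *lens*: a capsule containing all these collars whose
interior lies in `V`.  In the rich-cut formulation (block B2a) a lens is a pair of continuous
semialgebraic functions `bot ≤ top` on `ℝᵐ` with

* (L1) `bot x < t ≤ top x ⇒ (x, t) ∈ V` (the lens piece is good), and
* (L2) `bot y = a y < top y` for `y ∈ Γ` (over the stratum the piece is a collar).

Construction ([Pawlucki2024, p. 3871]): the tube around `Γ` is parametrized by the chart
projection `π x = φ (x ∘ ι)` and the transversal size `d x = dist x (π x)`; the collar height is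
`ε = min (e - a, dist (· ∘ ι, ∁U))` (so that the lens pinches towards the frontier of the
stratum); the radius function is the running minimum `ρ̃(y,t) = min_{s ∈ [t, a y + ε y]}
d((y,s), ∁V)/2`, made strictly increasing as `ρ̂ = min(ρ̃, ε) · clamp((t - a)/ε)`; the lens
bottom is the fibrewise inverse `bot x = ρ̂(π x, ·)⁻¹ (d x)` on the tube `d x < ρ̂(π x, top)`,
and the lens is closed off by a Tietze extension of the top.  (L1) is the disc argument
`dist((x,t), (π x, t)) = d x < d((π x, t), ∁V)`; continuity at the frontier of the stratum is a
squeeze (`ε(π x) ≤ dist(x ∘ ι, ∁U) ≤ dist(x, z)` for `z` outside the chart cylinder).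

No named facts are introduced (D-0026).

## References

* [Pawlucki2024] W. Pawłucki, *Strict `C^p`-triangulations — a new approach to
  desingularization*, J. Eur. Math. Soc. 26 (2024), 3863–3909, Prop. 2.5, proof, Part I.
* [Dries1998] L. van den Dries, *Tame topology and o-minimal structures*, Ch. 3 (2.7) (charts of
  cells), Ch. 6 (1.2)/(3.5)–(3.7) (definable choice; used upstream).
* [OhmotoShiota2017] T. Ohmoto, M. Shiota, *`C¹`-triangulations of semialgebraic sets*,
  J. Topology 10 (2017), Thm. 1.1 (statement only).
-/

noncomputable section

open Set Filter Metric
open _root_.Topology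

namespace Literature.ModelTheory.ExponentialFields

open Literature.NumberTheory.Transcendental (IsSemialgebraicFunOn IsSemialgebraicMapOn
  isSemialgebraicFunOn_iff isSemialgebraicMapOn_iff_forall_holds)

section Lens

variable {m k : ℕ}

/-- The data of a lens: a stratum `Γ ⊆ ℝᵐ` with chart `(ι, U, φ)`, a member `V` of the cover,
the (globally continuous) bottom function `a` and the collar height function `e`.
[cite: Pawlucki2024, Prop. 2.5 (proof, Part I)] -/
structure LensData (m k : ℕ) where
  /-- the stratum -/
  Γ : Set (Fin m → ℝ)
  /-- chart coordinates -/
  ι : Fin k → Fin m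
  /-- chart domain (open) -/
  U : Set (Fin k → ℝ)
  /-- chart inverse -/
  φ : (Fin k → ℝ) → (Fin m → ℝ)
  /-- the member of the cover -/
  V : Set (Fin (m + 1) → ℝ)
  /-- bottom graph -/
  a : (Fin m → ℝ) → ℝ
  /-- collar height -/
  e : (Fin m → ℝ) → ℝ

/-- The hypotheses (topological layer). [cite: Pawlucki2024, Prop. 2.5 (proof, Part I)] -/
structure LensData.Hyp (L : LensData m k) : Prop where
  Γ_bdd : Bornology.IsBounded L.Γ
  isOpen_U : IsOpen L.U
  chart_left : ∀ x ∈ L.Γ, L.φ (x ∘ L.ι) = x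
  chart_mem : ∀ x ∈ L.Γ, x ∘ L.ι ∈ L.U
  chart_right : ∀ u ∈ L.U, L.φ u ∈ L.Γ ∧ (L.φ u) ∘ L.ι = u
  φ_cont : ContinuousOn L.φ L.U
  isOpen_V : IsOpen L.V
  a_cont : Continuous L.a
  e_cont : ContinuousOn L.e L.Γ
  a_lt_e : ∀ y ∈ L.Γ, L.a y < L.e y
  collar : ∀ y ∈ L.Γ, ∀ t ∈ Ioc (L.a y) (L.e y), (Fin.snoc y t : Fin (m + 1) → ℝ) ∈ L.V

namespace LensData

variable (L : LensData m k)

/-- Chart coordinates of a point. [cite: Dries1998, Ch. 3 (2.7)] -/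
def pr (x : Fin m → ℝ) : Fin k → ℝ := x ∘ L.ι

/-- The chart cylinder `{x : x ∘ ι ∈ U}`. [cite: Dries1998, Ch. 3 (2.7)] -/
def Cyl : Set (Fin m → ℝ) := {x | L.pr x ∈ L.U}

/-- The chart projection onto the stratum. [cite: Pawlucki2024, Prop. 2.5 (proof, Part I)] -/
def proj (x : Fin m → ℝ) : Fin m → ℝ := L.φ (L.pr x)

/-- Transversal size `d(x) = dist(x, π x)`. [cite: Pawlucki2024, Prop. 2.5 (proof, Part I)] -/
def tdist (x : Fin m → ℝ) : ℝ := dist x (L.proj x)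

/-- Distance to the complement of the chart domain (`1` if the domain is everything).
[cite: Pawlucki2024, Prop. 2.5 (proof, Part I)] -/
def δU (u : Fin k → ℝ) : ℝ := by
  classical
  exact if (L.Uᶜ).Nonempty then infDist u L.Uᶜ else 1

/-- Collar height `ε = min (e - a, δU ∘ pr)`. [cite: Pawlucki2024, Prop. 2.5 (proof, Part I)] -/
def eps (y : Fin m → ℝ) : ℝ := min (L.e y - L.a y) (L.δU (L.pr y))

/-- Top of the collar `a + ε`. [cite: Pawlucki2024, Prop. 2.5 (proof, Part I)] -/
def top₀ (y : Fin m → ℝ) : ℝ := L.a y + L.eps y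

/-- Distance to the complement of `V` (`1` if `V` is everything). [cite: Pawlucki2024, Prop. 2.5] -/
def GV (z : Fin (m + 1) → ℝ) : ℝ := by
  classical
  exact if (L.Vᶜ).Nonempty then infDist z L.Vᶜ else 1

/-- Half-distance along the fibre: `F(y, s) = d((y,s), ∁V)/2`. [cite: Pawlucki2024, p. 3871, `θ`] -/
def F (y : Fin m → ℝ) (s : ℝ) : ℝ := L.GV (Fin.snoc y s) / 2

/-- Running minimum `ρ̃(y, t) = min_{s ∈ [t, top₀ y]} F(y, s)` (nondecreasing in `t`).
[cite: Pawlucki2024, p. 3871, "we can modify `θ`"] -/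
def ρt (y : Fin m → ℝ) (t : ℝ) : ℝ := paramMin L.F L.top₀ y t

/-- Clamp into `[0, 1]`. [folklore] -/
def clamp01 (u : ℝ) : ℝ := max 0 (min u 1)

/-- The strictly increasing radius function `ρ̂(y, t) = min(ρ̃, ε) · clamp((t - a)/ε)`.
[cite: Pawlucki2024, p. 3871] -/
def ρh (y : Fin m → ℝ) (t : ℝ) : ℝ := min (L.ρt y t) (L.eps y) * clamp01 ((t - L.a y) / L.eps y)

/-- Tube radius `r(y) = ρ̂(y, top₀ y)`. [cite: Pawlucki2024, p. 3871] -/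
def rad (y : Fin m → ℝ) : ℝ := L.ρh y (L.top₀ y)

/-- The tube around the stratum. [cite: Pawlucki2024, p. 3871, the set `E`] -/
def Tube : Set (Fin m → ℝ) := {x | x ∈ L.Cyl ∧ L.tdist x < L.rad (L.proj x)}

/-- The fibrewise inverse of `ρ̂`. [cite: Pawlucki2024, p. 3871, `θ⁻¹`] -/
def Ψ (y : Fin m → ℝ) (ρ : ℝ) : ℝ := paramInv L.Γ L.a L.top₀ L.ρh y ρ

end LensData

/-- `min` of two functions continuous on a set. [folklore] -/
theorem continuousOn_min₂ {X : Type*} [TopologicalSpace X] {f g : X → ℝ} {s : Set X}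
    (hf : ContinuousOn f s) (hg : ContinuousOn g s) : ContinuousOn (fun x => min (f x) (g x)) s :=
  continuous_min.comp_continuousOn (hf.prodMk hg)

/-- `(y, s) ↦ Fin.snoc y s` is continuous. [folklore] -/
theorem continuous_snoc_prod' : Continuous fun p : (Fin m → ℝ) × ℝ => (Fin.snoc p.1 p.2 : Fin (m + 1) → ℝ) := by
  refine continuous_pi fun i => ?_
  refine Fin.lastCases ?_ (fun j => ?_) i
  · simp only [Fin.snoc_last]; exact continuous_snd
  · simp only [Fin.snoc_castSucc]; exact (continuous_apply j).comp continuous_fst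

namespace LensData

variable {L : LensData m k} (H : L.Hyp)
include H

/-! ### Chart basics -/

/-- On the stratum the projection is the identity. [cite: Dries1998, Ch. 3 (2.7)] -/
theorem proj_of_mem {x : Fin m → ℝ} (hx : x ∈ L.Γ) : L.proj x = x := H.chart_left x hx

/-- The stratum lies in the chart cylinder. [cite: Dries1998, Ch. 3 (2.7)] -/
theorem mem_Cyl_of_mem {x : Fin m → ℝ} (hx : x ∈ L.Γ) : x ∈ L.Cyl := H.chart_mem x hx

/-- The projection lands in the stratum. [cite: Dries1998, Ch. 3 (2.7)] -/
theorem proj_mem {x : Fin m → ℝ} (hx : x ∈ L.Cyl) : L.proj x ∈ L.Γ := (H.chart_right _ hx).1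

/-- The projection preserves chart coordinates. [cite: Dries1998, Ch. 3 (2.7)] -/
theorem pr_proj {x : Fin m → ℝ} (hx : x ∈ L.Cyl) : L.pr (L.proj x) = L.pr x := (H.chart_right _ hx).2

omit H in
/-- The chart coordinate map is continuous. [folklore] -/
theorem continuous_pr : Continuous L.pr :=
  continuous_pi fun j => continuous_apply (L.ι j)

omit H in
/-- The chart coordinate map is `1`-Lipschitz (sup metric). [folklore] -/
theorem dist_pr_le (x z : Fin m → ℝ) : dist (L.pr x) (L.pr z) ≤ dist x z :=
  (dist_pi_le_iff dist_nonneg).2 fun j => dist_le_pi_dist x z (L.ι j)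

/-- The chart cylinder is open. [cite: Dries1998, Ch. 3 (2.7)] -/
theorem isOpen_Cyl : IsOpen L.Cyl := H.isOpen_U.preimage continuous_pr

/-- The projection is continuous on the cylinder. [cite: Dries1998, Ch. 3 (2.7)] -/
theorem continuousOn_proj : ContinuousOn L.proj L.Cyl :=
  H.φ_cont.comp continuous_pr.continuousOn fun _ hx => hx

/-- The transversal size is continuous on the cylinder. [cite: Pawlucki2024, Prop. 2.5] -/
theorem continuousOn_tdist : ContinuousOn L.tdist L.Cyl :=
  continuous_dist.comp_continuousOn (continuousOn_id.prodMk (continuousOn_proj H))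

/-- On the stratum the transversal size vanishes. [cite: Pawlucki2024, Prop. 2.5] -/
theorem tdist_of_mem {x : Fin m → ℝ} (hx : x ∈ L.Γ) : L.tdist x = 0 := by
  unfold tdist; rw [proj_of_mem H hx, dist_self]

/-! ### The collar height `ε` -/

omit H in
/-- `δU` is continuous. [cite: Pawlucki2024, Prop. 2.5] -/
theorem continuous_δU : Continuous L.δU := by
  unfold δU
  split_ifs
  · exact continuous_infDist_pt _
  · exact continuous_const

/-- `δU > 0` on the chart domain. [cite: Pawlucki2024, Prop. 2.5] -/
theorem δU_pos {u : Fin k → ℝ} (hu : u ∈ L.U) : 0 < L.δU u := by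
  unfold δU
  split_ifs with h
  · exact (infDist_compl_pos_iff H.isOpen_U h).2 hu
  · exact one_pos

omit H in
/-- `δU u ≤ dist u w` for `w` outside the chart domain. [cite: Pawlucki2024, Prop. 2.5] -/
theorem δU_le_dist {u w : Fin k → ℝ} (hw : w ∉ L.U) : L.δU u ≤ dist u w := by
  unfold δU
  rw [if_pos ⟨w, hw⟩]
  exact infDist_le_dist_of_mem hw

/-- `ε` is continuous on the stratum. [cite: Pawlucki2024, Prop. 2.5] -/
theorem continuousOn_eps : ContinuousOn L.eps L.Γ := by
  unfold eps
  exact continuous_min.comp_continuousOn ((H.e_cont.sub H.a_cont.continuousOn).prodMk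
    (continuous_δU.comp_continuousOn continuous_pr.continuousOn))

/-- `ε > 0` on the stratum. [cite: Pawlucki2024, Prop. 2.5] -/
theorem eps_pos {y : Fin m → ℝ} (hy : y ∈ L.Γ) : 0 < L.eps y :=
  lt_min (sub_pos.2 (H.a_lt_e y hy)) (δU_pos H (H.chart_mem y hy))

omit H in
/-- `ε ≤ e - a`. [cite: Pawlucki2024, Prop. 2.5] -/
theorem eps_le_sub (y : Fin m → ℝ) : L.eps y ≤ L.e y - L.a y := min_le_left _ _

omit H in
/-- `ε ≤ δU ∘ pr`. [cite: Pawlucki2024, Prop. 2.5] -/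
theorem eps_le_δU (y : Fin m → ℝ) : L.eps y ≤ L.δU (L.pr y) := min_le_right _ _

/-- `top₀` is continuous on the stratum. [cite: Pawlucki2024, Prop. 2.5] -/
theorem continuousOn_top₀ : ContinuousOn L.top₀ L.Γ :=
  H.a_cont.continuousOn.add (continuousOn_eps H)

/-- `a < top₀` on the stratum. [cite: Pawlucki2024, Prop. 2.5] -/
theorem a_lt_top₀ {y : Fin m → ℝ} (hy : y ∈ L.Γ) : L.a y < L.top₀ y := by
  unfold top₀; linarith [eps_pos H hy]

omit H in
/-- `top₀ = a + ε`. [cite: Pawlucki2024, Prop. 2.5] -/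
theorem top₀_sub_a (y : Fin m → ℝ) : L.top₀ y - L.a y = L.eps y := by unfold top₀; ring

/-- The collar up to `top₀` lies in `V`. [cite: Pawlucki2024, Prop. 2.5] -/
theorem snoc_mem_V {y : Fin m → ℝ} (hy : y ∈ L.Γ) {t : ℝ} (ht : t ∈ Ioc (L.a y) (L.top₀ y)) :
    (Fin.snoc y t : Fin (m + 1) → ℝ) ∈ L.V :=
  H.collar y hy t ⟨ht.1, ht.2.trans (by unfold top₀; linarith [eps_le_sub (L := L) y])⟩

/-! ### Distance to the complement of `V` -/

omit H in
/-- `GV` is continuous. [cite: Pawlucki2024, Prop. 2.5] -/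
theorem continuous_GV : Continuous L.GV := by
  unfold GV
  split_ifs
  · exact continuous_infDist_pt _
  · exact continuous_const

omit H in
/-- `GV ≥ 0`. [cite: Pawlucki2024, Prop. 2.5] -/
theorem GV_nonneg (z : Fin (m + 1) → ℝ) : 0 ≤ L.GV z := by
  unfold GV
  split_ifs
  · exact infDist_nonneg
  · exact zero_le_one

/-- `GV > 0` on `V`. [cite: Pawlucki2024, Prop. 2.5] -/
theorem GV_pos {z : Fin (m + 1) → ℝ} (hz : z ∈ L.V) : 0 < L.GV z := by
  unfold GV
  split_ifs with h
  · exact (infDist_compl_pos_iff H.isOpen_V h).2 hz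
  · exact one_pos

omit H in
/-- **The disc argument**: points within `GV z` of `z` lie in `V`. [cite: Pawlucki2024, p. 3871] -/
theorem mem_V_of_dist_lt {z w : Fin (m + 1) → ℝ} (h : dist z w < L.GV z) : w ∈ L.V := by
  unfold GV at h
  split_ifs at h with hne
  · exact mem_of_dist_lt_infDist_compl h
  · rw [not_nonempty_iff_eq_empty, compl_empty_iff] at hne
    rw [hne]; exact mem_univ _

attribute [local irreducible] LensData.GV LensData.δU

omit H in
/-- `F` is continuous (jointly). [cite: Pawlucki2024, Prop. 2.5] -/
theorem continuous_F : Continuous fun p : (Fin m → ℝ) × ℝ => L.F p.1 p.2 := by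
  unfold F
  exact (continuous_GV.comp continuous_snoc_prod').div_const _

omit H in
/-- `F(y, ·)` is continuous. [cite: Pawlucki2024, Prop. 2.5] -/
theorem continuous_F_fibre (y : Fin m → ℝ) : Continuous (L.F y) :=
  (show Continuous (Function.uncurry L.F) from continuous_F).uncurry_left y

attribute [local irreducible] LensData.F

/-- `F(y, s) > 0` on the collar. [cite: Pawlucki2024, Prop. 2.5] -/
theorem F_pos {y : Fin m → ℝ} (hy : y ∈ L.Γ) {s : ℝ} (hs : s ∈ Ioc (L.a y) (L.top₀ y)) : 0 < L.F y s := by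
  unfold F
  exact div_pos (GV_pos H (snoc_mem_V H hy hs)) two_pos

omit H in
/-- `F ≥ 0`. [cite: Pawlucki2024, Prop. 2.5] -/
theorem F_nonneg (y : Fin m → ℝ) (s : ℝ) : 0 ≤ L.F y s := by
  unfold F; exact div_nonneg (GV_nonneg _) zero_le_two

/-! ### The radius functions `ρ̃`, `ρ̂`, `r` -/

omit H in
/-- `ρ̃ ≤ F`. [cite: Pawlucki2024, p. 3871] -/
theorem ρt_le_F {y : Fin m → ℝ} {t : ℝ} (ht : t ≤ L.top₀ y) : L.ρt y t ≤ L.F y t :=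
  paramMin_le (F := L.F) (T := L.top₀) (continuous_F_fibre y).continuousOn ⟨le_rfl, ht⟩

/-- `ρ̃ > 0` strictly inside the collar. [cite: Pawlucki2024, p. 3871] -/
theorem ρt_pos {y : Fin m → ℝ} (hy : y ∈ L.Γ) {t : ℝ} (ht : t ∈ Ioc (L.a y) (L.top₀ y)) : 0 < L.ρt y t := by
  obtain ⟨s, hs, hseq⟩ := exists_paramMin_eq (F := L.F) (T := L.top₀)
    (continuous_F_fibre y).continuousOn ht.2
  unfold ρt
  rw [hseq]
  exact F_pos H hy ⟨ht.1.trans_le hs.1, hs.2⟩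

omit H in
/-- `ρ̃ ≥ 0`. [cite: Pawlucki2024, p. 3871] -/
theorem ρt_nonneg {y : Fin m → ℝ} {t : ℝ} (ht : t ≤ L.top₀ y) : 0 ≤ L.ρt y t := by
  obtain ⟨s, _, hseq⟩ := exists_paramMin_eq (F := L.F) (T := L.top₀)
    (continuous_F_fibre y).continuousOn ht
  unfold ρt
  rw [hseq]
  exact F_nonneg _ _

omit H in
/-- `ρ̃` is nondecreasing in `t`. [cite: Pawlucki2024, p. 3871] -/
theorem ρt_mono {y : Fin m → ℝ} {t t' : ℝ} (htt' : t ≤ t') (ht' : t' ≤ L.top₀ y) : L.ρt y t ≤ L.ρt y t' :=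
  paramMin_mono (F := L.F) (T := L.top₀) (continuous_F_fibre y).continuousOn htt' ht'

omit H in
/-- `ρ̃` at the top. [cite: Pawlucki2024, p. 3871] -/
theorem ρt_top (y : Fin m → ℝ) : L.ρt y (L.top₀ y) = L.F y (L.top₀ y) := paramMin_top y

/-- `ρ̃` is jointly continuous on `{(y,t) : y ∈ Γ, a y ≤ t ≤ top₀ y}`. [cite: Pawlucki2024, p. 3871] -/
theorem continuousOn_ρt :
    ContinuousOn (fun p : (Fin m → ℝ) × ℝ => L.ρt p.1 p.2)
      {p | p.1 ∈ L.Γ ∧ L.a p.1 ≤ p.2 ∧ p.2 ≤ L.top₀ p.1} := by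
  unfold ρt
  exact continuousOn_paramMin (lo := L.a) (continuousOn_top₀ H) continuous_F.continuousOn

attribute [local irreducible] LensData.ρt

omit H in
/-- `clamp01` takes values in `[0, 1]`. [folklore] -/
theorem clamp01_mem (u : ℝ) : clamp01 u ∈ Icc (0 : ℝ) 1 :=
  ⟨le_max_left _ _, max_le zero_le_one (min_le_right _ _)⟩

omit H in
/-- `clamp01` is the identity on `[0, 1]`. [folklore] -/
theorem clamp01_of_mem {u : ℝ} (hu : u ∈ Icc (0 : ℝ) 1) : clamp01 u = u := by
  unfold clamp01; rw [min_eq_left hu.2, max_eq_right hu.1]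

omit H in
/-- `clamp01` is continuous. [folklore] -/
theorem continuous_clamp01 : Continuous clamp01 :=
  continuous_const.max (continuous_id.min continuous_const)

omit H in
/-- `ρ̂(y, a y) = 0`. [cite: Pawlucki2024, p. 3871] -/
theorem ρh_bot (y : Fin m → ℝ) : L.ρh y (L.a y) = 0 := by
  unfold ρh
  rw [sub_self, zero_div, clamp01_of_mem ⟨le_rfl, zero_le_one⟩, mul_zero]

/-- The clamp factor on the collar is `(t - a)/ε ∈ [0, 1]`. [cite: Pawlucki2024, p. 3871] -/
theorem clamp_eq {y : Fin m → ℝ} (hy : y ∈ L.Γ) {t : ℝ} (ht : t ∈ Icc (L.a y) (L.top₀ y)) :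
    clamp01 ((t - L.a y) / L.eps y) = (t - L.a y) / L.eps y := by
  have hε := eps_pos H hy
  refine clamp01_of_mem ⟨div_nonneg (sub_nonneg.2 ht.1) hε.le, ?_⟩
  rw [div_le_one hε, ← top₀_sub_a]
  linarith [ht.2]

/-- `ρ̂ > 0` strictly inside the collar. [cite: Pawlucki2024, p. 3871] -/
theorem ρh_pos {y : Fin m → ℝ} (hy : y ∈ L.Γ) {t : ℝ} (ht : t ∈ Ioc (L.a y) (L.top₀ y)) : 0 < L.ρh y t := by
  unfold ρh
  rw [clamp_eq H hy ⟨ht.1.le, ht.2⟩]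
  exact mul_pos (lt_min (ρt_pos H hy ht) (eps_pos H hy)) (div_pos (sub_pos.2 ht.1) (eps_pos H hy))

omit H in
/-- `ρ̂ ≤ ρ̃`. [cite: Pawlucki2024, p. 3871] -/
theorem ρh_le_ρt {y : Fin m → ℝ} {t : ℝ} (ht : t ≤ L.top₀ y) : L.ρh y t ≤ L.ρt y t := by
  unfold ρh
  have h1 : min (L.ρt y t) (L.eps y) ≤ L.ρt y t := min_le_left _ _
  have h2 := clamp01_mem ((t - L.a y) / L.eps y)
  have h0 : 0 ≤ L.ρt y t := ρt_nonneg ht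
  rcases le_or_gt 0 (min (L.ρt y t) (L.eps y)) with hm | hm
  · calc min (L.ρt y t) (L.eps y) * clamp01 ((t - L.a y) / L.eps y)
        ≤ min (L.ρt y t) (L.eps y) * 1 := mul_le_mul_of_nonneg_left h2.2 hm
      _ ≤ L.ρt y t := by rw [mul_one]; exact h1
  · calc min (L.ρt y t) (L.eps y) * clamp01 ((t - L.a y) / L.eps y)
        ≤ 0 := mul_nonpos_of_nonpos_of_nonneg hm.le h2.1
      _ ≤ L.ρt y t := h0

/-- `ρ̂ ≤ ε` on the stratum. [cite: Pawlucki2024, p. 3871] -/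
theorem ρh_le_eps {y : Fin m → ℝ} (hy : y ∈ L.Γ) (t : ℝ) : L.ρh y t ≤ L.eps y := by
  unfold ρh
  have h2 := clamp01_mem ((t - L.a y) / L.eps y)
  have hε := (eps_pos H hy).le
  calc min (L.ρt y t) (L.eps y) * clamp01 ((t - L.a y) / L.eps y)
      ≤ L.eps y * clamp01 ((t - L.a y) / L.eps y) := mul_le_mul_of_nonneg_right (min_le_right _ _) h2.1
    _ ≤ L.eps y * 1 := mul_le_mul_of_nonneg_left h2.2 hε
    _ = L.eps y := mul_one _

/-- **`ρ̂(y, ·)` is strictly increasing on `[a y, top₀ y]`.** [cite: Pawlucki2024, p. 3871] -/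
theorem ρh_strictMonoOn {y : Fin m → ℝ} (hy : y ∈ L.Γ) :
    StrictMonoOn (L.ρh y) (Icc (L.a y) (L.top₀ y)) := by
  intro t ht t' ht' htt'
  rcases eq_or_lt_of_le ht.1 with heq | hlt
  · rw [← heq, ρh_bot y]
    exact ρh_pos H hy ⟨lt_of_le_of_lt ht.1 htt', ht'.2⟩
  · unfold ρh
    rw [clamp_eq H hy ht, clamp_eq H hy ht']
    have hε := eps_pos H hy
    have g1 : min (L.ρt y t) (L.eps y) ≤ min (L.ρt y t') (L.eps y) :=
      min_le_min (ρt_mono htt'.le ht'.2) le_rfl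
    have g1pos : 0 < min (L.ρt y t) (L.eps y) := lt_min (ρt_pos H hy ⟨hlt, ht.2⟩) hε
    have g2 : (t - L.a y) / L.eps y < (t' - L.a y) / L.eps y :=
      div_lt_div_of_pos_right (by linarith) hε
    have g2pos : 0 < (t - L.a y) / L.eps y := div_pos (sub_pos.2 hlt) hε
    calc min (L.ρt y t) (L.eps y) * ((t - L.a y) / L.eps y)
        < min (L.ρt y t) (L.eps y) * ((t' - L.a y) / L.eps y) := mul_lt_mul_of_pos_left g2 g1pos
      _ ≤ min (L.ρt y t') (L.eps y) * ((t' - L.a y) / L.eps y) :=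
          mul_le_mul_of_nonneg_right g1 (g2pos.trans g2).le

/-- `ρ̂` is jointly continuous on `{(y,t) : y ∈ Γ, a y ≤ t ≤ top₀ y}`. [cite: Pawlucki2024, p. 3871] -/
theorem continuousOn_ρh :
    ContinuousOn (fun p : (Fin m → ℝ) × ℝ => L.ρh p.1 p.2)
      {p | p.1 ∈ L.Γ ∧ L.a p.1 ≤ p.2 ∧ p.2 ≤ L.top₀ p.1} := by
  have hε : ContinuousOn (fun p : (Fin m → ℝ) × ℝ => L.eps p.1) {p | p.1 ∈ L.Γ ∧ L.a p.1 ≤ p.2 ∧ p.2 ≤ L.top₀ p.1} :=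
    (continuousOn_eps H).comp continuousOn_fst fun p hp => hp.1
  have ha : ContinuousOn (fun p : (Fin m → ℝ) × ℝ => L.a p.1) {p | p.1 ∈ L.Γ ∧ L.a p.1 ≤ p.2 ∧ p.2 ≤ L.top₀ p.1} :=
    H.a_cont.comp_continuousOn continuousOn_fst
  unfold ρh
  refine (continuousOn_min₂ (continuousOn_ρt H) hε).mul (continuous_clamp01.comp_continuousOn ?_)
  exact (continuousOn_snd.sub ha).div hε fun p hp => (eps_pos H hp.1).ne'

/-- `ρ̂(y, ·)` is continuous on `[a y, top₀ y]`. [cite: Pawlucki2024, p. 3871] -/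
theorem continuousOn_ρh_fibre {y : Fin m → ℝ} (hy : y ∈ L.Γ) :
    ContinuousOn (L.ρh y) (Icc (L.a y) (L.top₀ y)) := by
  have h := (continuousOn_ρh H).comp (f := fun t : ℝ => (y, t))
    (continuousOn_const.prodMk continuousOn_id) fun t (ht : t ∈ Icc (L.a y) (L.top₀ y)) => ⟨hy, ht.1, ht.2⟩
  exact h

omit H in
/-- Unfolding the tube radius. [cite: Pawlucki2024, p. 3871] -/
theorem rad_def (y : Fin m → ℝ) : L.rad y = L.ρh y (L.top₀ y) := rfl

/-- The tube radius: `r(y) = min (F(y, top₀ y)) (ε y)`. [cite: Pawlucki2024, p. 3871] -/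
theorem rad_eq {y : Fin m → ℝ} (hy : y ∈ L.Γ) : L.rad y = min (L.F y (L.top₀ y)) (L.eps y) := by
  unfold rad ρh
  rw [clamp_eq H hy ⟨(a_lt_top₀ H hy).le, le_rfl⟩, top₀_sub_a, div_self (eps_pos H hy).ne', mul_one,
    ρt_top]

/-- `r > 0` on the stratum. [cite: Pawlucki2024, p. 3871] -/
theorem rad_pos {y : Fin m → ℝ} (hy : y ∈ L.Γ) : 0 < L.rad y := by
  rw [rad_eq H hy]
  exact lt_min (F_pos H hy ⟨a_lt_top₀ H hy, le_rfl⟩) (eps_pos H hy)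

/-- `r ≤ ε`. [cite: Pawlucki2024, p. 3871] -/
theorem rad_le_eps {y : Fin m → ℝ} (hy : y ∈ L.Γ) : L.rad y ≤ L.eps y := ρh_le_eps H hy _

/-- `r` is continuous on the stratum. [cite: Pawlucki2024, p. 3871] -/
theorem continuousOn_rad : ContinuousOn L.rad L.Γ := by
  have h : ContinuousOn (fun y => min (L.F y (L.top₀ y)) (L.eps y)) L.Γ :=
    continuousOn_min₂ (continuous_F.comp_continuousOn (continuousOn_id.prodMk (continuousOn_top₀ H)))
      (continuousOn_eps H)
  exact h.congr fun y hy => rad_eq H hy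

attribute [local irreducible] LensData.ρh LensData.rad


/-! ### The fibrewise inverse `Ψ` -/

/-- The stratum is relatively locally compact (through its chart). [cite: Dries1998, Ch. 3 (2.7)] -/
theorem exists_compact_mem_nhdsWithin_Γ {y : Fin m → ℝ} (hy : y ∈ L.Γ) :
    ∃ K ⊆ L.Γ, IsCompact K ∧ K ∈ 𝓝[L.Γ] y := by
  obtain ⟨δ, hδ, hball⟩ := Metric.isOpen_iff.1 H.isOpen_U (L.pr y) (H.chart_mem y hy)
  have hcb : closedBall (L.pr y) (δ / 2) ⊆ L.U := (closedBall_subset_ball (by linarith)).trans hball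
  refine ⟨L.φ '' closedBall (L.pr y) (δ / 2), ?_, (isCompact_closedBall _ _).image_of_continuousOn
    (H.φ_cont.mono hcb), ?_⟩
  · rintro _ ⟨u, hu, rfl⟩
    exact (H.chart_right u (hcb hu)).1
  · refine mem_nhdsWithin.2 ⟨L.pr ⁻¹' ball (L.pr y) (δ / 2), isOpen_ball.preimage continuous_pr,
      mem_ball_self (by linarith), ?_⟩
    rintro x ⟨hx, hxΓ⟩
    exact ⟨L.pr x, ball_subset_closedBall hx, H.chart_left x hxΓ⟩

/-- **`Ψ` is jointly continuous** on `{(y, ρ) : y ∈ Γ, 0 ≤ ρ ≤ r y}`. [cite: Pawlucki2024, p. 3871] -/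
theorem continuousOn_Ψ :
    ContinuousOn (fun p : (Fin m → ℝ) × ℝ => L.Ψ p.1 p.2) {p | p.1 ∈ L.Γ ∧ 0 ≤ p.2 ∧ p.2 ≤ L.rad p.1} := by
  have h := continuousOn_paramInv (S := L.Γ) (lo := L.a) (hi := L.top₀) (φ := L.ρh)
    (fun y hy => ρh_strictMonoOn H hy) (fun y hy => (a_lt_top₀ H hy).le) H.a_cont.continuousOn
    (continuousOn_top₀ H) (continuousOn_ρh H) (fun y hy => exists_compact_mem_nhdsWithin_Γ H hy)
  refine h.mono fun p hp => ?_
  refine ⟨hp.1, ?_, ?_⟩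
  · show L.ρh p.1 (L.a p.1) ≤ p.2
    rw [ρh_bot]; exact hp.2.1
  · show p.2 ≤ L.ρh p.1 (L.top₀ p.1)
    rw [← rad_def]; exact hp.2.2

/-- Specification of `Ψ`: for `y ∈ Γ` and `ρ ∈ [0, r y]`, `Ψ y ρ ∈ [a y, top₀ y]` and `ρ̂(y, Ψ y ρ) = ρ`.
[cite: Pawlucki2024, p. 3871] -/
theorem Ψ_spec {y : Fin m → ℝ} (hy : y ∈ L.Γ) {ρ : ℝ} (hρ : ρ ∈ Icc 0 (L.rad y)) :
    L.Ψ y ρ ∈ Icc (L.a y) (L.top₀ y) ∧ L.ρh y (L.Ψ y ρ) = ρ := by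
  have h := paramInv_spec (S := L.Γ) (lo := L.a) (hi := L.top₀) (φ := L.ρh)
    (fun y hy => ρh_strictMonoOn H hy) (fun y hy => (a_lt_top₀ H hy).le)
    (fun y hy => continuousOn_ρh_fibre H hy) hy (r := ρ) ?_
  · exact h
  · rw [ρh_bot, ← rad_def]; exact hρ

/-- `Ψ y 0 = a y`. [cite: Pawlucki2024, p. 3871] -/
theorem Ψ_zero {y : Fin m → ℝ} (hy : y ∈ L.Γ) : L.Ψ y 0 = L.a y := by
  have h := paramInv_apply (S := L.Γ) (lo := L.a) (hi := L.top₀) (φ := L.ρh)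
    (fun y hy => ρh_strictMonoOn H hy) hy (t := L.a y) ⟨le_rfl, (a_lt_top₀ H hy).le⟩
  rw [ρh_bot] at h
  exact h

/-- `Ψ y (r y) = top₀ y`. [cite: Pawlucki2024, p. 3871] -/
theorem Ψ_rad {y : Fin m → ℝ} (hy : y ∈ L.Γ) : L.Ψ y (L.rad y) = L.top₀ y := by
  rw [rad_def]
  exact paramInv_apply (S := L.Γ) (lo := L.a) (hi := L.top₀) (φ := L.ρh)
    (fun y hy => ρh_strictMonoOn H hy) hy (t := L.top₀ y) ⟨(a_lt_top₀ H hy).le, le_rfl⟩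

attribute [local irreducible] LensData.Ψ

/-! ### The tube -/

/-- The tube is open. [cite: Pawlucki2024, p. 3871] -/
theorem isOpen_Tube : IsOpen L.Tube := by
  have h : ContinuousOn (fun x => L.rad (L.proj x) - L.tdist x) L.Cyl :=
    ((continuousOn_rad H).comp (continuousOn_proj H) fun x hx => proj_mem H hx).sub (continuousOn_tdist H)
  have h' := h.isOpen_inter_preimage (isOpen_Cyl H) isOpen_Ioi (t := Ioi (0 : ℝ))
  convert h' using 1
  ext x
  simp only [Tube, mem_setOf_eq, mem_inter_iff, mem_preimage, mem_Ioi, sub_pos]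

omit H in
/-- The tube lies in the cylinder. [cite: Pawlucki2024, p. 3871] -/
theorem Tube_subset_Cyl : L.Tube ⊆ L.Cyl := fun _ hx => hx.1

/-- The stratum lies in the tube. [cite: Pawlucki2024, p. 3871] -/
theorem mem_Tube_of_mem {y : Fin m → ℝ} (hy : y ∈ L.Γ) : y ∈ L.Tube := by
  refine ⟨mem_Cyl_of_mem H hy, ?_⟩
  rw [tdist_of_mem H hy, proj_of_mem H hy]
  exact rad_pos H hy

/-- **Key estimate** for points of the closed tube against points outside the cylinder:
`ε(π x) ≤ dist x z` and `dist (π x) z ≤ 2 dist x z`. [cite: Pawlucki2024, p. 3871] -/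
theorem eps_proj_le_dist {x z : Fin m → ℝ} (hx : x ∈ L.Cyl) (hz : z ∉ L.Cyl) :
    L.eps (L.proj x) ≤ dist x z := by
  calc L.eps (L.proj x) ≤ L.δU (L.pr (L.proj x)) := eps_le_δU _
    _ = L.δU (L.pr x) := by rw [pr_proj H hx]
    _ ≤ dist (L.pr x) (L.pr z) := δU_le_dist hz
    _ ≤ dist x z := dist_pr_le x z

/-- Second half of the key estimate. [cite: Pawlucki2024, p. 3871] -/
theorem dist_proj_le {x z : Fin m → ℝ} (hx : x ∈ L.Cyl) (hd : L.tdist x ≤ L.rad (L.proj x))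
    (hz : z ∉ L.Cyl) : dist (L.proj x) z ≤ 2 * dist x z := by
  have h1 : L.tdist x ≤ dist x z :=
    hd.trans ((rad_le_eps H (proj_mem H hx)).trans (eps_proj_le_dist H hx hz))
  calc dist (L.proj x) z ≤ dist (L.proj x) x + dist x z := dist_triangle _ _ _
    _ = L.tdist x + dist x z := by unfold tdist; rw [dist_comm]
    _ ≤ 2 * dist x z := by linarith

/-- Points of the closure of the tube inside the cylinder satisfy `d ≤ r ∘ π`.
[cite: Pawlucki2024, p. 3871] -/
theorem tdist_le_of_mem_closure {x : Fin m → ℝ} (hx : x ∈ closure L.Tube) (hxC : x ∈ L.Cyl) :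
    L.tdist x ≤ L.rad (L.proj x) := by
  have hc : ContinuousOn (fun x => L.rad (L.proj x) - L.tdist x) L.Cyl :=
    ((continuousOn_rad H).comp (continuousOn_proj H) fun x hx => proj_mem H hx).sub (continuousOn_tdist H)
  have hca : ContinuousAt (fun x => L.rad (L.proj x) - L.tdist x) x := hc.continuousAt ((isOpen_Cyl H).mem_nhds hxC)
  have hge : ∀ x' ∈ L.Tube, 0 ≤ L.rad (L.proj x') - L.tdist x' := fun x' hx' => by linarith [hx'.2]
  haveI : (𝓝[L.Tube] x).NeBot := mem_closure_iff_nhdsWithin_neBot.1 hx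
  have htend : Tendsto (fun x => L.rad (L.proj x) - L.tdist x) (𝓝[L.Tube] x)
      (𝓝 (L.rad (L.proj x) - L.tdist x)) := hca.tendsto.mono_left nhdsWithin_le_nhds
  have h : 0 ≤ L.rad (L.proj x) - L.tdist x :=
    ge_of_tendsto htend (eventually_nhdsWithin_of_forall hge)
  linarith

/-- The closed-tube function `g`: `top₀ ∘ π` inside the cylinder, `a` outside. [cite: Pawlucki2024, p. 3871] -/
def gfun (x : Fin m → ℝ) : ℝ := by
  classical
  exact if x ∈ L.Cyl then L.top₀ (L.proj x) else L.a x

/-- **`g` is continuous on the closure of the tube** (squeeze at the frontier of the stratum).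
[cite: Pawlucki2024, p. 3871] -/
theorem continuousOn_gfun_closure : ContinuousOn L.gfun (closure L.Tube) := by
  classical
  intro x₀ hx₀
  by_cases hC : x₀ ∈ L.Cyl
  · -- near `x₀` we are in the cylinder: `g = top₀ ∘ π`
    have hcont : ContinuousOn (fun x => L.top₀ (L.proj x)) L.Cyl :=
      (continuousOn_top₀ H).comp (continuousOn_proj H) fun x hx => proj_mem H hx
    have hca : ContinuousAt (fun x => L.top₀ (L.proj x)) x₀ := hcont.continuousAt ((isOpen_Cyl H).mem_nhds hC)
    have heq : L.gfun =ᶠ[𝓝 x₀] fun x => L.top₀ (L.proj x) := by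
      filter_upwards [(isOpen_Cyl H).mem_nhds hC] with x hx
      unfold gfun; rw [if_pos hx]
    exact (hca.congr heq.symm).continuousWithinAt
  · -- squeeze: `|g x - a x₀| ≤ |a(π x) - a x₀| + dist x x₀` with `dist (π x) x₀ ≤ 2 dist x x₀`
    rw [Metric.continuousWithinAt_iff]
    intro ε hε
    obtain ⟨δ, hδ, ha⟩ := Metric.continuousAt_iff.1 (H.a_cont.continuousAt (x := x₀)) (ε / 2) (by linarith)
    refine ⟨min (δ / 2) (ε / 2), lt_min (by linarith) (by linarith), fun x hx hdist => ?_⟩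
    have hd1 : dist x x₀ < δ / 2 := lt_of_lt_of_le hdist (min_le_left _ _)
    have hd2 : dist x x₀ < ε / 2 := lt_of_lt_of_le hdist (min_le_right _ _)
    have hg0 : L.gfun x₀ = L.a x₀ := by unfold gfun; rw [if_neg hC]
    rw [hg0]
    by_cases hxC : x ∈ L.Cyl
    · have hgx : L.gfun x = L.top₀ (L.proj x) := by unfold gfun; rw [if_pos hxC]
      rw [hgx]
      have hle := tdist_le_of_mem_closure H hx hxC
      have hpd : dist (L.proj x) x₀ < δ := by
        have := dist_proj_le H hxC hle hC; linarith
      have h1 : dist (L.a (L.proj x)) (L.a x₀) < ε / 2 := ha hpd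
      have h2 : L.eps (L.proj x) ≤ dist x x₀ := eps_proj_le_dist H hxC hC
      rw [Real.dist_eq] at h1 ⊢
      unfold top₀
      have h3 : 0 < L.eps (L.proj x) := eps_pos H (proj_mem H hxC)
      calc |L.a (L.proj x) + L.eps (L.proj x) - L.a x₀|
          ≤ |L.a (L.proj x) - L.a x₀| + L.eps (L.proj x) := by
            rw [show L.a (L.proj x) + L.eps (L.proj x) - L.a x₀ = (L.a (L.proj x) - L.a x₀) + L.eps (L.proj x) by ring]
            exact (abs_add_le _ _).trans (by rw [abs_of_pos h3])
        _ < ε / 2 + ε / 2 := by linarith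
        _ = ε := by ring
    · have hgx : L.gfun x = L.a x := by unfold gfun; rw [if_neg hxC]
      rw [hgx]
      exact (ha (by linarith [hd1])).trans (by linarith)

/-- The tube is bounded. [cite: Pawlucki2024, p. 3871] -/
theorem isBounded_Tube : Bornology.IsBounded L.Tube := by
  -- `x ∈ Tube ⇒ dist x (π x) < ε(π x) ≤ δU (pr x)`; `δU` is bounded on the bounded set `pr '' Γ`
  obtain ⟨R, hR⟩ : ∃ R, ∀ y ∈ L.Γ, ∀ y' ∈ L.Γ, dist y y' ≤ R := by
    obtain ⟨R, hR⟩ := Metric.isBounded_iff.1 H.Γ_bdd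
    exact ⟨R, fun y hy y' hy' => hR hy hy'⟩
  rcases L.Γ.eq_empty_or_nonempty with hΓ | ⟨y₀, hy₀⟩
  · have : L.Tube = ∅ := by
      ext x
      simp only [mem_empty_iff_false, iff_false]
      intro hx
      have := proj_mem H hx.1
      rw [hΓ] at this
      exact this
    rw [this]; exact Bornology.isBounded_empty
  -- bound on `δU (pr x)` for `x ∈ Cyl`: `δU (pr x) = δU (pr (π x))` and `π x ∈ Γ`
  obtain ⟨B, hB⟩ : ∃ B, ∀ y ∈ L.Γ, L.δU (L.pr y) ≤ B := by
    by_cases hne : (L.Uᶜ).Nonempty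
    · obtain ⟨w, hw⟩ := hne
      refine ⟨R + dist (L.pr y₀) w, fun y hy => ?_⟩
      calc L.δU (L.pr y) ≤ dist (L.pr y) w := δU_le_dist hw
        _ ≤ dist (L.pr y) (L.pr y₀) + dist (L.pr y₀) w := dist_triangle _ _ _
        _ ≤ dist y y₀ + dist (L.pr y₀) w := by linarith [dist_pr_le (L := L) y y₀]
        _ ≤ R + dist (L.pr y₀) w := by linarith [hR y hy y₀ hy₀]
    · refine ⟨1, fun y _ => ?_⟩
      unfold δU; rw [if_neg hne]
  rw [Metric.isBounded_iff_subset_closedBall y₀]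
  refine ⟨B + R, fun x hx => ?_⟩
  rw [mem_closedBall]
  have hxC := hx.1
  have hpm := proj_mem H hxC
  calc dist x y₀ ≤ dist x (L.proj x) + dist (L.proj x) y₀ := dist_triangle _ _ _
    _ = L.tdist x + dist (L.proj x) y₀ := rfl
    _ ≤ L.eps (L.proj x) + R := by linarith [hx.2, rad_le_eps H hpm, hR _ hpm y₀ hy₀]
    _ ≤ L.δU (L.pr (L.proj x)) + R := by linarith [eps_le_δU (L := L) (L.proj x)]
    _ ≤ B + R := by linarith [hB _ hpm]

/-- The closure of the tube is compact. [cite: Pawlucki2024, p. 3871] -/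
theorem isCompact_closure_Tube : IsCompact (closure L.Tube) :=
  (isBounded_Tube H).isCompact_closure

/-! ### The lens bottom on the tube -/

/-- The lens bottom on the tube: `Ψ(π x, d x)`. [cite: Pawlucki2024, p. 3871, `θ⁻¹(x₁…x_k, |x''|)`] -/
def bot₀ (x : Fin m → ℝ) : ℝ := L.Ψ (L.proj x) (L.tdist x)

/-- `bot₀` is continuous on the closed tube `{x ∈ Cyl : d x ≤ r (π x)}`. [cite: Pawlucki2024, p. 3871] -/
theorem continuousOn_bot₀ : ContinuousOn L.bot₀ {x | x ∈ L.Cyl ∧ L.tdist x ≤ L.rad (L.proj x)} := by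
  unfold bot₀
  refine (continuousOn_Ψ H).comp ((continuousOn_proj H).prodMk (continuousOn_tdist H) |>.mono fun x hx => hx.1)
    fun x hx => ?_
  exact ⟨proj_mem H hx.1, dist_nonneg, hx.2⟩

/-- On the tube, `a (π x) ≤ bot₀ x ≤ top₀ (π x)`. [cite: Pawlucki2024, p. 3871] -/
theorem bot₀_mem {x : Fin m → ℝ} (hxC : x ∈ L.Cyl) (hd : L.tdist x ≤ L.rad (L.proj x)) :
    L.bot₀ x ∈ Icc (L.a (L.proj x)) (L.top₀ (L.proj x)) :=
  (Ψ_spec H (proj_mem H hxC) ⟨dist_nonneg, hd⟩).1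

/-- On the stratum `bot₀ = a`. [cite: Pawlucki2024, p. 3871] -/
theorem bot₀_of_mem {y : Fin m → ℝ} (hy : y ∈ L.Γ) : L.bot₀ y = L.a y := by
  unfold bot₀; rw [tdist_of_mem H hy, proj_of_mem H hy, Ψ_zero H hy]

/-- **The disc argument (L1) on the tube**: `bot₀ x < t ≤ top₀ (π x) ⇒ (x, t) ∈ V`.
[cite: Pawlucki2024, p. 3871] -/
theorem snoc_mem_V_of_bot₀_lt {x : Fin m → ℝ} (hx : x ∈ L.Tube) {t : ℝ} (h1 : L.bot₀ x < t)
    (h2 : t ≤ L.top₀ (L.proj x)) : (Fin.snoc x t : Fin (m + 1) → ℝ) ∈ L.V := by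
  have hy : L.proj x ∈ L.Γ := proj_mem H hx.1
  have hspec := Ψ_spec H hy (ρ := L.tdist x) ⟨dist_nonneg, hx.2.le⟩
  have hb : L.bot₀ x ∈ Icc (L.a (L.proj x)) (L.top₀ (L.proj x)) := hspec.1
  have ht : t ∈ Icc (L.a (L.proj x)) (L.top₀ (L.proj x)) := ⟨hb.1.trans h1.le, h2⟩
  -- `ρ̂(π x, t) > d(x)`
  have hρ : L.tdist x < L.ρh (L.proj x) t := by
    have := ρh_strictMonoOn H hy hb ht h1
    have hb' : L.ρh (L.proj x) (L.bot₀ x) = L.tdist x := hspec.2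
    rw [hb'] at this
    exact this
  -- `F(π x, t) > d(x)`
  have hF : L.tdist x < L.F (L.proj x) t := lt_of_lt_of_le hρ ((ρh_le_ρt ht.2).trans (ρt_le_F ht.2))
  -- `dist ((π x, t), (x, t)) = d(x)`
  have hdist : dist (Fin.snoc (L.proj x) t : Fin (m + 1) → ℝ) (Fin.snoc x t) = L.tdist x := by
    unfold tdist
    rw [dist_comm x]
    apply le_antisymm
    · refine (dist_pi_le_iff dist_nonneg).2 fun i => ?_
      refine Fin.lastCases ?_ (fun j => ?_) i
      · simp
      · simp only [Fin.snoc_castSucc]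
        exact dist_le_pi_dist (L.proj x) x j
    · refine (dist_pi_le_iff dist_nonneg).2 fun j => ?_
      have h := dist_le_pi_dist (Fin.snoc (L.proj x) t : Fin (m + 1) → ℝ) (Fin.snoc x t) (Fin.castSucc j)
      simpa only [Fin.snoc_castSucc] using h
  refine mem_V_of_dist_lt (z := Fin.snoc (L.proj x) t) ?_
  rw [hdist]
  have hF' : L.tdist x < L.GV (Fin.snoc (L.proj x) t) / 2 := by
    have h := hF; unfold F at h; exact h
  linarith [GV_nonneg (L := L) (Fin.snoc (L.proj x) t)]


/-! ### Continuity of the glued lens bottom -/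

/-- The glued lens bottom: `bot₀` on the tube, `T` outside. [cite: Pawlucki2024, p. 3871] -/
def botFun (T : (Fin m → ℝ) → ℝ) (x : Fin m → ℝ) : ℝ := by
  classical
  exact if x ∈ L.Tube then L.bot₀ x else T x

/-- **The glued lens bottom is continuous**, for any continuous `T` extending `g` from the closure of
the tube. [cite: Pawlucki2024, p. 3871] -/
theorem continuous_botFun {T : (Fin m → ℝ) → ℝ} (hT : Continuous T) (hTg : EqOn T L.gfun (closure L.Tube)) :
    Continuous (L.botFun T) := by
  classical
  rw [continuous_iff_continuousAt]
  intro x₀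
  by_cases h1 : x₀ ∈ L.Tube
  · -- inside the open tube
    have heq : L.botFun T =ᶠ[𝓝 x₀] L.bot₀ := by
      filter_upwards [(isOpen_Tube H).mem_nhds h1] with x hx
      unfold botFun; rw [if_pos hx]
    have hca : ContinuousAt L.bot₀ x₀ :=
      (continuousOn_bot₀ H).continuousAt (Filter.mem_of_superset ((isOpen_Tube H).mem_nhds h1)
        fun x hx => ⟨hx.1, hx.2.le⟩)
    exact hca.congr heq.symm
  by_cases h2 : x₀ ∈ closure L.Tube
  · -- on the boundary of the tube: glue
    have hval : L.botFun T x₀ = T x₀ := by unfold botFun; rw [if_neg h1]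
    have hTx : T x₀ = L.gfun x₀ := hTg h2
    -- within the complement: `T`
    have hout : ContinuousWithinAt (L.botFun T) (L.Tube)ᶜ x₀ := by
      refine (hT.continuousWithinAt).congr (fun x hx => ?_) hval
      unfold botFun; rw [if_neg (show x ∉ L.Tube from hx)]
    -- within the tube: `bot₀ → g x₀`
    have hin : ContinuousWithinAt (L.botFun T) L.Tube x₀ := by
      have hev : ∀ x ∈ L.Tube, L.botFun T x = L.bot₀ x := fun x hx => by unfold botFun; rw [if_pos hx]
      rw [ContinuousWithinAt, hval, hTx]
      refine Tendsto.congr' (eventually_nhdsWithin_of_forall fun x hx => (hev x hx).symm) ?_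
      by_cases hC : x₀ ∈ L.Cyl
      · have hle := tdist_le_of_mem_closure H h2 hC
        have hge : L.rad (L.proj x₀) ≤ L.tdist x₀ := by
          by_contra hlt; exact h1 ⟨hC, not_le.1 hlt⟩
        have heq : L.tdist x₀ = L.rad (L.proj x₀) := le_antisymm hle hge
        have hg : L.gfun x₀ = L.bot₀ x₀ := by
          unfold gfun bot₀
          rw [if_pos hC, heq, Ψ_rad H (proj_mem H hC)]
        rw [hg]
        have hcw : ContinuousWithinAt L.bot₀ {x | x ∈ L.Cyl ∧ L.tdist x ≤ L.rad (L.proj x)} x₀ :=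
          continuousOn_bot₀ H x₀ ⟨hC, hle⟩
        exact hcw.tendsto.mono_left (nhdsWithin_mono _ fun x hx => ⟨hx.1, hx.2.le⟩)
      · -- squeeze at the frontier of the stratum
        have hg0 : L.gfun x₀ = L.a x₀ := by unfold gfun; rw [if_neg hC]
        rw [hg0, Metric.tendsto_nhdsWithin_nhds]
        intro ε hε
        obtain ⟨δ, hδ, ha⟩ := Metric.continuousAt_iff.1 (H.a_cont.continuousAt (x := x₀)) (ε / 2) (by linarith)
        refine ⟨min (δ / 2) (ε / 2), lt_min (by linarith) (by linarith), fun x hx hdist => ?_⟩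
        have hd1 : dist x x₀ < δ / 2 := lt_of_lt_of_le hdist (min_le_left _ _)
        have hd2 : dist x x₀ < ε / 2 := lt_of_lt_of_le hdist (min_le_right _ _)
        have hxC := hx.1
        have hb := bot₀_mem H hxC hx.2.le
        have hpd : dist (L.proj x) x₀ < δ := by
          have := dist_proj_le H hxC hx.2.le hC; linarith
        have h1' : dist (L.a (L.proj x)) (L.a x₀) < ε / 2 := ha hpd
        have h2' : L.eps (L.proj x) ≤ dist x x₀ := eps_proj_le_dist H hxC hC
        rw [Real.dist_eq] at h1' ⊢
        rw [abs_lt] at h1' ⊢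
        have htop : L.top₀ (L.proj x) = L.a (L.proj x) + L.eps (L.proj x) := rfl
        constructor
        · linarith [hb.1]
        · linarith [hb.2]
    have h := hin.union hout
    rw [union_compl_self, continuousWithinAt_univ] at h
    exact h
  · -- outside the closure: `T`
    have heq : L.botFun T =ᶠ[𝓝 x₀] T := by
      filter_upwards [(isClosed_closure (s := L.Tube)).isOpen_compl.mem_nhds h2] with x hx
      unfold botFun; rw [if_neg (fun h => hx (subset_closure h))]
    exact hT.continuousAt.congr heq.symm

/-- `botFun T ≤ T` when `T` extends `g`. [cite: Pawlucki2024, p. 3871] -/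
theorem botFun_le {T : (Fin m → ℝ) → ℝ} (hTg : EqOn T L.gfun (closure L.Tube)) (x : Fin m → ℝ) :
    L.botFun T x ≤ T x := by
  classical
  unfold botFun
  split_ifs with hx
  · rw [hTg (subset_closure hx)]
    unfold gfun; rw [if_pos hx.1]
    exact (bot₀_mem H hx.1 hx.2.le).2
  · exact le_rfl

/-- **(L1) for the glued lens**: `bot x < t ≤ T x ⇒ (x, t) ∈ V`. [cite: Pawlucki2024, p. 3871] -/
theorem snoc_mem_V_of_botFun_lt {T : (Fin m → ℝ) → ℝ} (hTg : EqOn T L.gfun (closure L.Tube))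
    {x : Fin m → ℝ} {t : ℝ} (h1 : L.botFun T x < t) (h2 : t ≤ T x) :
    (Fin.snoc x t : Fin (m + 1) → ℝ) ∈ L.V := by
  classical
  by_cases hx : x ∈ L.Tube
  · have hb : L.botFun T x = L.bot₀ x := by unfold botFun; rw [if_pos hx]
    rw [hb] at h1
    rw [hTg (subset_closure hx)] at h2
    have hT : L.gfun x = L.top₀ (L.proj x) := by unfold gfun; rw [if_pos hx.1]
    rw [hT] at h2
    exact snoc_mem_V_of_bot₀_lt H hx h1 h2
  · have hb : L.botFun T x = T x := by unfold botFun; rw [if_neg hx]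
    rw [hb] at h1
    exact absurd (h1.trans_le h2) (lt_irrefl _)

/-- **(L2) for the glued lens**: over the stratum the piece is the collar `[a y, top₀ y]`.
[cite: Pawlucki2024, p. 3871] -/
theorem botFun_of_mem {T : (Fin m → ℝ) → ℝ} (hTg : EqOn T L.gfun (closure L.Tube)) {y : Fin m → ℝ}
    (hy : y ∈ L.Γ) : L.botFun T y = L.a y ∧ T y = L.top₀ y := by
  classical
  have hyT := mem_Tube_of_mem H hy
  constructor
  · unfold botFun; rw [if_pos hyT]; exact bot₀_of_mem H hy
  · rw [hTg (subset_closure hyT)]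
    unfold gfun; rw [if_pos hyT.1, proj_of_mem H hy]

end LensData

end Lens

/-! ### The semialgebraic layer -/

section SA

variable {m : ℕ}

open Literature.NumberTheory.Transcendental.SemialgebraicMonotonicity (sa_and sa_or sa_not sa_imp
  sa_lt sa_le sa_eq sa_sub_lt sa_reindex sa_const_lt sa_lt_const sa_le_const sa_const_le)

/-- Piecewise semialgebraic functions are semialgebraic. [cite: BochnakCosteRoy1998, §2.2] -/
theorem IsSemialgebraicFunOn.piecewise_mem {s A : Set (Fin m → ℝ)}
    {f g : (Fin m → ℝ) → ℝ} (hf : IsSemialgebraicFunOn ℝ (s ∩ A) f)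
    (hg : IsSemialgebraicFunOn ℝ (s \ A) g) [DecidablePred (· ∈ A)] :
    IsSemialgebraicFunOn ℝ s (fun x => if x ∈ A then f x else g x) := by
  rw [isSemialgebraicFunOn_iff] at hf hg ⊢
  convert hf.union hg using 1
  ext q
  simp only [mem_setOf_eq, mem_inter_iff, Set.mem_sdiff, mem_union]
  by_cases h : Fin.init q ∈ A
  · simp [h]
  · simp [h]

/-- The atom `z i - z j ≤ z l`. [cite: BochnakCosteRoy1998, Def. 2.1.4] -/
theorem sa_sub_le {p : ℕ} (i j l : Fin p) : IsSemialgebraic ℝ {z : Fin p → ℝ | z i - z j ≤ z l} := by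
  have h := isSemialgebraic_setOf_eval_le (k := ℝ) (R := ℝ) (MvPolynomial.X i - MvPolynomial.X j :
    MvPolynomial (Fin p) ℝ) (MvPolynomial.X l)
  simp only [map_sub, MvPolynomial.aeval_X] at h
  exact h

/-- The atom `|z i - z j| ≤ z l`. [cite: BochnakCosteRoy1998, §2.1] -/
theorem sa_abs_sub_le {p : ℕ} (i j l : Fin p) : IsSemialgebraic ℝ {z : Fin p → ℝ | |z i - z j| ≤ z l} := by
  convert (sa_sub_le i j l).inter (sa_sub_le j i l) using 1
  ext z; simp only [mem_setOf_eq, mem_inter_iff, abs_sub_le_iff]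

/-- First-order description of the sup distance. [folklore] -/
theorem eq_dist_pi_iff {n : ℕ} (u v : Fin n → ℝ) (t : ℝ) :
    t = dist u v ↔ 0 ≤ t ∧ (∀ i, |u i - v i| ≤ t) ∧ (t ≤ 0 ∨ ∃ i, t ≤ |u i - v i|) := by
  constructor
  · rintro rfl
    refine ⟨dist_nonneg, fun i => by simpa [Real.dist_eq] using dist_le_pi_dist u v i, ?_⟩
    rcases eq_or_lt_of_le (dist_nonneg (x := u) (y := v)) with h | h
    · exact Or.inl h.symm.le
    · obtain ⟨⟨i, hi⟩, -⟩ := (dist_pi_eq_iff h).1 rfl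
      exact Or.inr ⟨i, by rw [Real.dist_eq] at hi; exact hi.symm.le⟩
  · rintro ⟨h0, h1, h2⟩
    have hle : dist u v ≤ t := (dist_pi_le_iff h0).2 fun i => by simpa [Real.dist_eq] using h1 i
    rcases h2 with h | ⟨i, hi⟩
    · exact le_antisymm (h.trans dist_nonneg) hle
    · exact le_antisymm (hi.trans (by simpa [Real.dist_eq] using dist_le_pi_dist u v i)) hle

/-- **The sup distance between a point and its image under a semialgebraic map is a semialgebraic
function.** [cite: BochnakCosteRoy1998, Prop. 2.2.8] -/
theorem isSemialgebraicFunOn_dist_map {s : Set (Fin m → ℝ)} (hs : IsSemialgebraic ℝ s)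
    {P : (Fin m → ℝ) → (Fin m → ℝ)} (hP : IsSemialgebraicMapOn ℝ s P) :
    IsSemialgebraicFunOn ℝ s (fun x => dist x (P x)) := by
  classical
  have hPj := (isSemialgebraicMapOn_iff_forall_holds hs).1 hP
  refine IsSemialgebraicFunOn.of_rel (N := m + m) hs
    (f := Fin.append (fun (i : Fin m) (x : Fin m → ℝ) => x i) (fun (i : Fin m) (x : Fin m → ℝ) => P x i))
    (fun i => ?_)
    (R := fun a t => 0 ≤ t ∧ (∀ i : Fin m, |a (Fin.castAdd m i) - a (Fin.natAdd m i)| ≤ t) ∧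
      (t ≤ 0 ∨ ∃ i : Fin m, t ≤ |a (Fin.castAdd m i) - a (Fin.natAdd m i)|)) ?_ (fun x _ t => ?_)
  · -- each `f i` is semialgebraic
    induction i using Fin.addCases with
    | left i => simpa only [Fin.append_left] using isSemialgebraicFunOn_apply hs i
    | right i => simpa only [Fin.append_right] using hPj i
  · -- the relation is semialgebraic
    refine sa_and (sa_const_le _ _) (sa_and ?_ (sa_or (sa_le_const _ _) ?_))
    · have h := IsSemialgebraic.biInter (Finset.univ : Finset (Fin m))
        (fun i => {q : Fin (m + m + 1) → ℝ | |q (Fin.castSucc (Fin.castAdd m i)) -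
          q (Fin.castSucc (Fin.natAdd m i))| ≤ q (Fin.last (m + m))})
        fun i _ => sa_abs_sub_le _ _ _
      convert h using 1
      ext q; simp [Fin.init]
    · have h := IsSemialgebraic.biUnion (Finset.univ : Finset (Fin m))
        (fun i => {q : Fin (m + m + 1) → ℝ | |q (Fin.castSucc (Fin.castAdd m i)) -
          q (Fin.castSucc (Fin.natAdd m i))| < q (Fin.last (m + m))}ᶜ)
        fun i _ => (sa_abs_sub_lt _ _ _).compl
      convert h using 1
      ext q; simp [Fin.init, not_lt]
  · -- the relation characterises `dist x (P x)`
    have h := eq_dist_pi_iff x (P x) t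
    simp only [Fin.append_left, Fin.append_right]
    rw [h]

namespace LensData

variable {k : ℕ} {L : LensData m k}

/-- Semialgebraicity hypotheses for a lens. [cite: Pawlucki2024, Prop. 2.5 (proof, Part I)] -/
structure SA (L : LensData m k) : Prop where
  Γ_sa : IsSemialgebraic ℝ L.Γ
  U_sa : IsSemialgebraic ℝ L.U
  φ_sa : IsSemialgebraicMapOn ℝ L.U L.φ
  V_sa : IsSemialgebraic ℝ L.V
  a_sa : IsSemialgebraicFunOn ℝ univ L.a
  e_sa : IsSemialgebraicFunOn ℝ L.Γ L.e

variable (H : L.Hyp) (S : L.SA)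
include H S

omit H S in
/-- `pr` is a semialgebraic map. [cite: BochnakCosteRoy1998, §2.2] -/
theorem pr_sa : IsSemialgebraicMapOn ℝ univ L.pr :=
  IsSemialgebraicMapOn.of_forall isSemialgebraic_univ fun j => isSemialgebraicFunOn_apply isSemialgebraic_univ (L.ι j)

omit H in
/-- The cylinder is semialgebraic. [cite: BochnakCosteRoy1998, §2.2] -/
theorem Cyl_sa : IsSemialgebraic ℝ L.Cyl := by
  have h := IsSemialgebraicMapOn.isSemialgebraic_sep_mem (pr_sa (L := L)) S.U_sa
  convert h using 1
  ext x; simp [Cyl]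

omit H in
/-- `proj` is a semialgebraic map on the cylinder. [cite: BochnakCosteRoy1998, §2.2] -/
theorem proj_sa : IsSemialgebraicMapOn ℝ L.Cyl L.proj := by
  have hφj := (isSemialgebraicMapOn_iff_forall_holds S.U_sa).1 S.φ_sa
  refine IsSemialgebraicMapOn.of_forall (Cyl_sa S) fun j => ?_
  have h := IsSemialgebraicFunOn.comp_isSemialgebraicMapOn_holds (hφj j)
    ((pr_sa (L := L)).mono (subset_univ _) (Cyl_sa S)) fun x hx => hx
  exact h

omit H in
/-- `tdist` is semialgebraic on the cylinder. [cite: BochnakCosteRoy1998, Prop. 2.2.8] -/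
theorem tdist_sa : IsSemialgebraicFunOn ℝ L.Cyl L.tdist := isSemialgebraicFunOn_dist_map (Cyl_sa S) (proj_sa S)

omit H in
/-- `δU` is semialgebraic. [cite: BochnakCosteRoy1998, Prop. 2.2.8] -/
theorem δU_sa : IsSemialgebraicFunOn ℝ univ L.δU := by
  unfold δU
  split_ifs
  · exact isSemialgebraicFunOn_infDist S.U_sa.compl
  · exact isSemialgebraicFunOn_const' isSemialgebraic_univ 1

omit H in
/-- `ε` is semialgebraic on the stratum. [cite: Pawlucki2024, Prop. 2.5] -/
theorem eps_sa : IsSemialgebraicFunOn ℝ L.Γ L.eps := by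
  unfold eps
  refine IsSemialgebraicFunOn.min S.Γ_sa (IsSemialgebraicFunOn.sub_holds S.e_sa
    (S.a_sa.mono (subset_univ _) S.Γ_sa)) ?_
  exact IsSemialgebraicFunOn.comp_isSemialgebraicMapOn_holds (δU_sa S)
    ((pr_sa (L := L)).mono (subset_univ _) S.Γ_sa) fun x _ => mem_univ _

omit H in
/-- `top₀` is semialgebraic on the stratum. [cite: Pawlucki2024, Prop. 2.5] -/
theorem top₀_sa : IsSemialgebraicFunOn ℝ L.Γ L.top₀ := by
  unfold top₀
  exact IsSemialgebraicFunOn.add_holds (S.a_sa.mono (subset_univ _) S.Γ_sa) (eps_sa S)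

omit H in
/-- `GV` is semialgebraic. [cite: BochnakCosteRoy1998, Prop. 2.2.8] -/
theorem GV_sa : IsSemialgebraicFunOn ℝ univ L.GV := by
  unfold GV
  split_ifs
  · exact isSemialgebraicFunOn_infDist S.V_sa.compl
  · exact isSemialgebraicFunOn_const' isSemialgebraic_univ 1

omit H in
/-- `F` is semialgebraic in `z = (y, s)`. [cite: Pawlucki2024, Prop. 2.5] -/
theorem F_sa : IsSemialgebraicFunOn ℝ univ (fun z : Fin (m + 1) → ℝ => L.F (Fin.init z) (z (Fin.last m))) := by
  have h : IsSemialgebraicFunOn ℝ univ (fun z : Fin (m + 1) → ℝ => L.GV z / 2) :=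
    IsSemialgebraicFunOn.div₀ isSemialgebraic_univ (GV_sa S) (isSemialgebraicFunOn_const' isSemialgebraic_univ 2)
  refine h.congr fun z _ => ?_
  show L.GV z / 2 = L.F (Fin.init z) (z (Fin.last m))
  unfold F; rw [Fin.snoc_init_self]

/-- The fibre region `{(y, t) : y ∈ Γ, a y ≤ t ≤ top₀ y}` in snoc coordinates. [cite: Pawlucki2024, Prop. 2.5] -/
def RΓ (L : LensData m k) : Set (Fin (m + 1) → ℝ) :=
  {z | Fin.init z ∈ L.Γ ∧ L.a (Fin.init z) ≤ z (Fin.last m) ∧ z (Fin.last m) ≤ L.top₀ (Fin.init z)}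

omit H in
/-- The fibre region is semialgebraic. [cite: Pawlucki2024, Prop. 2.5] -/
theorem RΓ_sa : IsSemialgebraic ℝ L.RΓ := by
  have h1 := IsSemialgebraicFunOn.isSemialgebraic_setOf_ge tarski_seidenberg_real_holds
    (S.a_sa.mono (subset_univ _) S.Γ_sa)
  have h2 := IsSemialgebraicFunOn.isSemialgebraic_setOf_le tarski_seidenberg_real_holds (top₀_sa S)
  convert h1.inter h2 using 1
  ext z; simp only [RΓ, mem_setOf_eq, mem_inter_iff]; tauto

omit H in
/-- `ρ̃` is semialgebraic on the fibre region. [cite: Pawlucki2024, Prop. 2.5] -/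
theorem ρt_sa : IsSemialgebraicFunOn ℝ L.RΓ (fun z => L.ρt (Fin.init z) (z (Fin.last m))) := by
  have h := isSemialgebraicFunOn_paramMin (S := L.Γ) (F := L.F) (lo := L.a) (T := L.top₀)
    (S.a_sa.mono (subset_univ _) S.Γ_sa) (top₀_sa S) (F_sa S) fun y _ => (continuous_F_fibre y).continuousOn
  exact h

omit H in
/-- `ρ̂` is semialgebraic on the fibre region. [cite: Pawlucki2024, Prop. 2.5] -/
theorem ρh_sa : IsSemialgebraicFunOn ℝ L.RΓ (fun z => L.ρh (Fin.init z) (z (Fin.last m))) := by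
  have hR := RΓ_sa S
  have heps : IsSemialgebraicFunOn ℝ L.RΓ (fun z => L.eps (Fin.init z)) :=
    (eps_sa S).comp_init.mono (fun z hz => hz.1) hR
  have ha : IsSemialgebraicFunOn ℝ L.RΓ (fun z => L.a (Fin.init z)) :=
    (S.a_sa.mono (subset_univ _) S.Γ_sa).comp_init.mono (fun z hz => hz.1) hR
  have hlast : IsSemialgebraicFunOn ℝ L.RΓ (fun z : Fin (m + 1) → ℝ => z (Fin.last m)) :=
    isSemialgebraicFunOn_apply hR (Fin.last m)
  have hq : IsSemialgebraicFunOn ℝ L.RΓ (fun z => (z (Fin.last m) - L.a (Fin.init z)) / L.eps (Fin.init z)) :=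
    IsSemialgebraicFunOn.div₀ hR (IsSemialgebraicFunOn.sub_holds hlast ha) heps
  have hcl : IsSemialgebraicFunOn ℝ L.RΓ (fun z => clamp01 ((z (Fin.last m) - L.a (Fin.init z)) / L.eps (Fin.init z))) := by
    unfold clamp01
    exact IsSemialgebraicFunOn.max hR (isSemialgebraicFunOn_const' hR 0)
      (IsSemialgebraicFunOn.min hR hq (isSemialgebraicFunOn_const' hR 1))
  have h := IsSemialgebraicFunOn.mul_holds (IsSemialgebraicFunOn.min hR (ρt_sa S) heps) hcl
  refine h.congr fun z _ => ?_
  show min (L.ρt (Fin.init z) (z (Fin.last m))) (L.eps (Fin.init z)) *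
      clamp01 ((z (Fin.last m) - L.a (Fin.init z)) / L.eps (Fin.init z)) = L.ρh (Fin.init z) (z (Fin.last m))
  rfl

/-- `r` is semialgebraic on the stratum. [cite: Pawlucki2024, Prop. 2.5] -/
theorem rad_sa : IsSemialgebraicFunOn ℝ L.Γ L.rad := by
  have hmap := isSemialgebraicMapOn_snoc S.Γ_sa (top₀_sa S)
  have hmaps : MapsTo (fun y : Fin m → ℝ => (Fin.snoc y (L.top₀ y) : Fin (m + 1) → ℝ)) L.Γ L.RΓ := by
    intro y hy
    simp only [RΓ, mem_setOf_eq, Fin.init_snoc, Fin.snoc_last]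
    exact ⟨hy, (a_lt_top₀ H hy).le, le_rfl⟩
  have h := IsSemialgebraicFunOn.comp_isSemialgebraicMapOn_holds (ρh_sa S) hmap hmaps
  refine h.congr fun y _ => ?_
  simp only [Function.comp, Fin.init_snoc, Fin.snoc_last]
  exact rad_def y

/-- The tube is semialgebraic. [cite: Pawlucki2024, Prop. 2.5] -/
theorem Tube_sa : IsSemialgebraic ℝ L.Tube := by
  have hC := Cyl_sa S
  have hrp : IsSemialgebraicFunOn ℝ L.Cyl (fun x => L.rad (L.proj x)) :=
    IsSemialgebraicFunOn.comp_isSemialgebraicMapOn_holds (rad_sa H S) (proj_sa S) fun x hx => proj_mem H hx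
  have hdiff := IsSemialgebraicFunOn.sub_holds hrp (tdist_sa S)
  have h := hdiff.isSemialgebraic_sep_snoc_mem tarski_seidenberg_real_holds
    (T := {z : Fin (m + 1) → ℝ | 0 < z (Fin.last m)}) (sa_const_lt _ _)
  convert h using 1
  ext x
  simp only [Tube, mem_setOf_eq, Fin.snoc_last, Pi.sub_apply, sub_pos]

/-- The closed tube `{x ∈ Cyl : d x ≤ r (π x)}` is semialgebraic. [cite: Pawlucki2024, Prop. 2.5] -/
theorem TubeC_sa : IsSemialgebraic ℝ {x | x ∈ L.Cyl ∧ L.tdist x ≤ L.rad (L.proj x)} := by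
  have hC := Cyl_sa S
  have hrp : IsSemialgebraicFunOn ℝ L.Cyl (fun x => L.rad (L.proj x)) :=
    IsSemialgebraicFunOn.comp_isSemialgebraicMapOn_holds (rad_sa H S) (proj_sa S) fun x hx => proj_mem H hx
  have hdiff := IsSemialgebraicFunOn.sub_holds hrp (tdist_sa S)
  have h := hdiff.isSemialgebraic_sep_snoc_mem tarski_seidenberg_real_holds
    (T := {z : Fin (m + 1) → ℝ | 0 ≤ z (Fin.last m)}) (sa_const_le _ _)
  convert h using 1
  ext x
  simp only [mem_setOf_eq, Fin.snoc_last, Pi.sub_apply, sub_nonneg]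

/-- `Ψ` is semialgebraic on `{(y, ρ) : y ∈ Γ, 0 ≤ ρ ≤ r y}`. [cite: Pawlucki2024, Prop. 2.5] -/
theorem Ψ_sa : IsSemialgebraicFunOn ℝ {w : Fin (m + 1) → ℝ | Fin.init w ∈ L.Γ ∧ 0 ≤ w (Fin.last m) ∧
      w (Fin.last m) ≤ L.rad (Fin.init w)} (fun w => L.Ψ (Fin.init w) (w (Fin.last m))) := by
  have h := isSemialgebraicFunOn_paramInv (S := L.Γ) (lo := L.a) (hi := L.top₀) (φ := L.ρh) S.Γ_sa
    (S.a_sa.mono (subset_univ _) S.Γ_sa) (top₀_sa S) (ρh_sa S) (fun y hy => ρh_strictMonoOn H hy)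
    (fun y hy => (a_lt_top₀ H hy).le) (fun y hy => continuousOn_ρh_fibre H hy)
  have hset : {w : Fin (m + 1) → ℝ | Fin.init w ∈ L.Γ ∧ L.ρh (Fin.init w) (L.a (Fin.init w)) ≤ w (Fin.last m) ∧
      w (Fin.last m) ≤ L.ρh (Fin.init w) (L.top₀ (Fin.init w))} =
      {w : Fin (m + 1) → ℝ | Fin.init w ∈ L.Γ ∧ 0 ≤ w (Fin.last m) ∧ w (Fin.last m) ≤ L.rad (Fin.init w)} := by
    ext w
    simp only [mem_setOf_eq, ρh_bot, rad_def]
  rw [hset] at h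
  exact h

/-- `bot₀` is semialgebraic on the closed tube. [cite: Pawlucki2024, Prop. 2.5] -/
theorem bot₀_sa : IsSemialgebraicFunOn ℝ {x | x ∈ L.Cyl ∧ L.tdist x ≤ L.rad (L.proj x)} L.bot₀ := by
  have hT := TubeC_sa H S
  have hprojT : IsSemialgebraicMapOn ℝ {x | x ∈ L.Cyl ∧ L.tdist x ≤ L.rad (L.proj x)} L.proj :=
    (proj_sa S).mono (fun x hx => hx.1) hT
  have htdT : IsSemialgebraicFunOn ℝ {x | x ∈ L.Cyl ∧ L.tdist x ≤ L.rad (L.proj x)} L.tdist :=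
    (tdist_sa S).mono (fun x hx => hx.1) hT
  have hprojj := (isSemialgebraicMapOn_iff_forall_holds hT).1 hprojT
  have hmap : IsSemialgebraicMapOn ℝ {x | x ∈ L.Cyl ∧ L.tdist x ≤ L.rad (L.proj x)}
      (fun x => (Fin.snoc (L.proj x) (L.tdist x) : Fin (m + 1) → ℝ)) := by
    refine IsSemialgebraicMapOn.of_forall hT fun j => ?_
    refine Fin.lastCases ?_ (fun i => ?_) j
    · simpa only [Fin.snoc_last] using htdT
    · simpa only [Fin.snoc_castSucc] using hprojj i
  have hmaps : MapsTo (fun x => (Fin.snoc (L.proj x) (L.tdist x) : Fin (m + 1) → ℝ))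
      {x | x ∈ L.Cyl ∧ L.tdist x ≤ L.rad (L.proj x)}
      {w : Fin (m + 1) → ℝ | Fin.init w ∈ L.Γ ∧ 0 ≤ w (Fin.last m) ∧ w (Fin.last m) ≤ L.rad (Fin.init w)} := by
    intro x hx
    simp only [mem_setOf_eq, Fin.init_snoc, Fin.snoc_last]
    exact ⟨proj_mem H hx.1, dist_nonneg, hx.2⟩
  have h := IsSemialgebraicFunOn.comp_isSemialgebraicMapOn_holds (Ψ_sa H S) hmap hmaps
  refine h.congr fun x _ => ?_
  simp only [Function.comp, Fin.init_snoc, Fin.snoc_last]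
  rfl

/-- `g` is semialgebraic (everywhere). [cite: Pawlucki2024, Prop. 2.5] -/
theorem gfun_sa : IsSemialgebraicFunOn ℝ univ L.gfun := by
  classical
  have hC := Cyl_sa S
  have h1 : IsSemialgebraicFunOn ℝ (univ ∩ L.Cyl) (fun x => L.top₀ (L.proj x)) := by
    rw [univ_inter]
    exact IsSemialgebraicFunOn.comp_isSemialgebraicMapOn_holds (top₀_sa S) (proj_sa S) fun x hx => proj_mem H hx
  have h2 : IsSemialgebraicFunOn ℝ (univ \ L.Cyl) L.a := S.a_sa.mono (fun x hx => hx.1) (isSemialgebraic_univ.diff hC)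
  have h := IsSemialgebraicFunOn.piecewise_mem h1 h2
  refine h.congr fun x _ => ?_
  unfold gfun
  rfl

/-- The glued bottom is semialgebraic for semialgebraic `T`. [cite: Pawlucki2024, Prop. 2.5] -/
theorem botFun_sa {T : (Fin m → ℝ) → ℝ} (hT : IsSemialgebraicFunOn ℝ univ T) : IsSemialgebraicFunOn ℝ univ (L.botFun T) := by
  classical
  have hTu := Tube_sa H S
  have h1 : IsSemialgebraicFunOn ℝ (univ ∩ L.Tube) L.bot₀ := by
    rw [univ_inter]
    exact (bot₀_sa H S).mono (fun x hx => ⟨hx.1, hx.2.le⟩) hTu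
  have h2 : IsSemialgebraicFunOn ℝ (univ \ L.Tube) T := hT.mono (fun x hx => hx.1) (isSemialgebraic_univ.diff hTu)
  have h := IsSemialgebraicFunOn.piecewise_mem h1 h2
  refine h.congr fun x _ => ?_
  unfold botFun
  rfl

/-! ### The lens theorem -/

/-- **Pawłucki's lens** [Pawlucki2024, Prop. 2.5, proof, Part I]: over a stratum `Γ` with chart,
on which the bottom graph `a` has collars `(a y, e y] ⊆ V` with `e` continuous, there are continuous
semialgebraic functions `bot ≤ top` on `ℝᵐ` such that the piece `(bot x, top x]` lies in `V` for every
`x` (L1) and is the collar `[a y, a y + ε y]`, `ε y > 0`, over `y ∈ Γ` (L2).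
[cite: Pawlucki2024, Prop. 2.5 (proof, Part I)] -/
theorem exists_lens :
    ∃ bot top : (Fin m → ℝ) → ℝ, Continuous bot ∧ Continuous top ∧
      IsSemialgebraicFunOn ℝ univ bot ∧ IsSemialgebraicFunOn ℝ univ top ∧
      (∀ x, bot x ≤ top x) ∧
      (∀ x t, bot x < t → t ≤ top x → (Fin.snoc x t : Fin (m + 1) → ℝ) ∈ L.V) ∧
      (∀ y ∈ L.Γ, bot y = L.a y ∧ L.a y < top y) := by
  -- Tietze extension of `g` from the closure of the tube
  have hcl : IsCompact (closure L.Tube) := isCompact_closure_Tube H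
  have hclsa : IsSemialgebraic ℝ (closure L.Tube) := isSemialgebraic_closure (Tube_sa H S)
  obtain ⟨T, hTc, hTsa, hTg⟩ := exists_continuous_semialgebraic_extension hcl hclsa
    ((gfun_sa H S).mono (subset_univ _) hclsa) (continuousOn_gfun_closure H)
  refine ⟨L.botFun T, T, continuous_botFun H hTc hTg, hTc, botFun_sa H S hTsa, hTsa,
    botFun_le H hTg, fun x t h1 h2 => snoc_mem_V_of_botFun_lt H hTg h1 h2, fun y hy => ?_⟩
  obtain ⟨h1, h2⟩ := botFun_of_mem H hTg hy
  exact ⟨h1, by rw [h2]; exact a_lt_top₀ H hy⟩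

end LensData

end SA

end Literature.ModelTheory.ExponentialFields
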